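import Literature.MathematicalPhysics.QuantumFieldTheory.Balaban1983to89.B6GOmegaReprV1

/-!
# `Balaban1983to89.B6GOmegaMarginV1` — T. Bałaban, *Propagators and renormalization transformations for lattice gauge
# theories. II*, Commun. Math. Phys. **96** (1984) 223–250 [Balaban1984PropagatorsII], Sect. A p. 228: the GEOMETRIC form of
# the hypotheses of the `G(Ω)` representation ON THE V1 MODEL — the block support of the averaging operators (1.18)/(2.20)
# and *"a neighbourhood Ω of the domain Ω₁ … a sum of big blocks"* ⇒ the interior/exterior dichotomy of
# `…B6GOmegaReprV1`; hence the locality of the minimiser `HB` under purely combinatorial conditions on the bond set `Ω`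

statement-level skeleton of published theorems with citation tags; proofs where landed; nothing here is a claim about the
Yang–Mills mass gap

PDF held: `paper:balaban1984-cmp96-propagators-rt-ii` (journal page = PDF page + 222); pp. 224, 226, 228 read AS IMAGES on
the ×2 renders `run/shared/lean/pub/pub-balaban/b2b-balaban-ref1/pages/1984-cmp96-propagators-rt-II/…-p002/p004/p006-x2.png`.

CITATION HEADER (lean-in-tree rule).  Cell `lit-balaban`, PHASE-2 proof seat **p21** (gen 6, file 9), B6 fold owner r03,
referee ref-4.  WHAT IS REPRODUCED: SKELETON row **B6.Txt@228** (completing the V1 model instance of gen 6 files 7–8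
`…B6GOmegaCriticalV1` / `…B6GOmegaReprV1`): the semantic hypotheses `IsInterior`/`IsExterior` of `hOp_local` DERIVED from
the block locality of `Q_j` ([Balaban1984PropagatorsI] (1.11)/(1.18), gen 5's `…B5AveragingLocalityV1.bondAvg_eq_zero_of_local`
iterated) and a combinatorial BLOCK-MARGIN condition on `Ω`.  One predicate definition with body (`IsBlockMargin`); theorems
otherwise; nothing restated.

PRINT (p. 228): *"Let us take a neighbourhood Ω of the domain Ω₁. We assume that it is a sum of big blocks of the lattice T₁.
… ω = 0 on Ω^c."*; (2.20) p. 226: *"(QA)(b) = (Q_jA)(b) for b ∈ Λ_j, (Q₀A)(b) = A(b)"*; [Balaban1984PropagatorsI] (1.18) p. 20: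
*"(Q_kA)_b = Σ_{x∈B^k(b₋)} η^{d+1} A([x, x(b)])"* (the average at a `k`-bond `b` involves only fine bonds under `B^k(b₋) ∪ B^k(b₊)`).

TYPED READING.  `IsBlockMargin D Ω`: for every constraint index of level `j ≥ 1` at the `j`-bond `b ∈ Λ_j`, every fine bond
whose end-points lie under the blocks `B^j(b₋) ∪ B^j(b₊)` belongs to `Ω`.  Under (2.1)–(2.2) (`Ω_j` unions of big blocks with
the separation `RM`, `L < RM`) these blocks lie inside `Ω_{j−1} ⊆ Ω₁` for `j ≥ 2` and inside the big-block neighbourhood of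
`Ω₁` for `j = 1`, so the print's `Ω` satisfies it; the V1 `Domains` do not carry (2.2), hence it is displayed as a hypothesis.
The interior set is taken SEMANTICALLY, `I = {i : (Q(ΩA))_i = (QA)_i ∀A}` (classically decidable); `IsInterior` is then
tautological and `IsExterior` is the content: a constraint that sees the cut-off is a `Λ₀`-bond outside `Ω` and vanishes on
`Ω`-fields.

WHAT IS PROVED (0 sorry, 0 new named facts; axioms standard).  `bondAvgIter_eq_zero_of_local` (BLOCK SUPPORT of `Q_j`:
`(Q_jA)(b) = 0` if `A` vanishes on the fine bonds under `B^j(b₋) ∪ B^j(b₊)`), `QE_cutB_apply_of_blocks` (a constraint whose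
blocks' bonds lie in `Ω` does not see the cut-off), `IsBlockMargin` (def), `isBlockMargin_top`, `isInterior_sem`,
**`isExterior_of_blockMargin`**,
**`hOp_local_geometric`** (gen 6's `hOp_local` under `IsMargin` + `IsBlockMargin` only: the minimiser `HB` on the bonds of `Ω`
is the printed `G(Ω)`-expression), `hOp_eq_GOmega_of_exterior_zero` (*"(2.35) with G(Ω) instead of G"*).
-/

noncomputable section

open scoped InnerProductSpace

namespace Literature.MathematicalPhysics.QuantumFieldTheory.Balaban1983to89.B6GOmegaMarginV1

open LatticeFieldCalculus B5Eq118OneStroke B5Eq120IterProof B5AveragingLocalityV1 B6SectADomainsV1 B6SectAOperatorsV1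
  B6SectAVectorModelV1 B6Eq238LocalInverseV1 B6GOmegaCriticalV1 B6GOmegaReprV1
open BalabanImbrieJaffe1984to88.BIJ85AxialPropagator411 (BondSpace)

variable {P : Params} (D : Domains P)

/-! ## §1. Block support of the `j`-fold average -/

/-- **BLOCK SUPPORT of `Q_j`** ((1.18): *"(Q_kA)_b = Σ_{x∈B^k(b₋)} η^{d+1}A([x, x(b)])"*, iterating gen 5's one-level
`bondAvg_eq_zero_of_local`): if the fine bond field vanishes on every fine bond whose two end-points lie under
`B^j(b₋) ∪ B^j(b₊)`, then `(Q_jA)(b) = 0` (`j` in the standing range). [cite: Balaban1984PropagatorsI, (1.18) p.20] -/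
theorem bondAvgIter_eq_zero_of_local :
    ∀ (j : ℕ), j ≤ P.m + P.K → ∀ (A : VecField P 0 ℝ) (b : PBond P j),
      (∀ b' : PBond P 0, (iterBlockOf j b'.src = b.src ∨ iterBlockOf j b'.src = b.tgt) →
        (iterBlockOf j b'.tgt = b.src ∨ iterBlockOf j b'.tgt = b.tgt) → A b' = 0) →
      bondAvgIter j A b = 0
  | 0, _, A, b, h => by
    rw [bondAvgIter_zero]
    exact h b (Or.inl (iterBlockOf_zero _)) (Or.inr (iterBlockOf_zero _))
  | j + 1, hj, A, b, h => by
    rw [bondAvgIter_succ]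
    refine bondAvg_eq_zero_of_local hj _ b fun b'' h1 h2 => ?_
    refine bondAvgIter_eq_zero_of_local j ((Nat.le_succ j).trans hj) A b'' fun b' h1' h2' => ?_
    have key : ∀ z : Site P 0, (iterBlockOf j z = b''.src ∨ iterBlockOf j z = b''.tgt) →
        (iterBlockOf (j + 1) z = b.src ∨ iterBlockOf (j + 1) z = b.tgt) := by
      rintro z (hz | hz) <;> rw [iterBlockOf_succ, hz]
      · exact h1
      · exact h2
    exact h b' (key _ h1') (key _ h2')

variable (Ω : PBond P 0 → Prop) [DecidablePred Ω]

/-- a constraint `(Q_jA)(b)`, `b ∈ Λ_j`, all of whose supporting fine bonds lie in `Ω` does not see the cut-off: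
`(Q(ΩA))_i = (QA)_i`. [cite: Balaban1984PropagatorsII, (2.20) p.226 + p.228 (ω = 0 on Ω^c)] -/
theorem QE_cutB_apply_of_blocks (i : BondIdx D)
    (h : ∀ b' : PBond P 0, (iterBlockOf i.1.1 b'.src = i.1.2.src ∨ iterBlockOf i.1.1 b'.src = i.1.2.tgt) →
      (iterBlockOf i.1.1 b'.tgt = i.1.2.src ∨ iterBlockOf i.1.1 b'.tgt = i.1.2.tgt) → Ω b') (x : BondSpace P) :
    QE D (cutB Ω x) i = QE D x i := by
  rw [← sub_eq_zero, ← PiLp.sub_apply, ← map_sub, QE_apply]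
  refine bondAvgIter_eq_zero_of_local (i.1.1 : ℕ) ((Nat.lt_succ_iff.mp i.1.1.2).trans D.hk) _ _ fun b' h1 h2 => ?_
  rw [WithLp.ofLp_sub, Pi.sub_apply, sub_eq_zero]
  exact (cutB_apply Ω x b').trans (if_pos (h b' h1 h2))

/-- **the block-margin condition** (*"a neighbourhood Ω of the domain Ω₁ … a sum of big blocks of the lattice T₁"*, with
(2.1)–(2.2)): `Ω` contains every fine bond lying under the two blocks `B^j(b₋) ∪ B^j(b₊)` of every averaged bond `b ∈ Λ_j`,
`j ≥ 1`. [cite: Balaban1984PropagatorsII, (2.2) p.224 + p.228 (neighbourhood Ω of Ω₁)] -/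
def IsBlockMargin (Ω : PBond P 0 → Prop) : Prop :=
  ∀ i : BondIdx D, 0 < (i.1.1 : ℕ) → ∀ b' : PBond P 0,
    (iterBlockOf i.1.1 b'.src = i.1.2.src ∨ iterBlockOf i.1.1 b'.src = i.1.2.tgt) →
      (iterBlockOf i.1.1 b'.tgt = i.1.2.src ∨ iterBlockOf i.1.1 b'.tgt = i.1.2.tgt) → Ω b'

/-- `Ω = T` (all bonds) satisfies the block margin (with `…B6GOmegaCriticalV1.isMargin_top`: the hypotheses of
`hOp_local_geometric` are jointly satisfiable; p. 224 *"we admit the case when some domains Ω_j are equal to T_η"*).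
[cite: Balaban1984PropagatorsII, (2.2) p.224 + p.228] -/
theorem isBlockMargin_top : IsBlockMargin D (fun _ : PBond P 0 => True) := fun _ _ _ _ _ => trivial

/-! ## §2. The dichotomy from the geometry -/

/-- the SEMANTIC interior set `I = {i : (Q(ΩA))_i = (QA)_i ∀A}` is interior by definition. [cite: Balaban1984PropagatorsII, p.228 (ω = 0 on Ω^c)] -/
theorem isInterior_sem : IsInterior D Ω (fun i => ∀ x : BondSpace P, QE D (cutB Ω x) i = QE D x i) := fun _ hi => hi

variable {Ω}

/-- **under the block margin every other constraint is exterior**: a constraint that sees the cut-off is (by §1) of level `0`,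
i.e. the evaluation `A(b)` at a `Λ₀`-bond `b ∉ Ω`, which vanishes on `Ω`-fields. [cite: Balaban1984PropagatorsII, (2.20) p.226 + p.228 (ω = 0 on Ω^c)] -/
theorem isExterior_of_blockMargin (hΩb : IsBlockMargin D Ω) :
    IsExterior D Ω (fun i => ∀ x : BondSpace P, QE D (cutB Ω x) i = QE D x i) := by
  rintro ⟨⟨⟨j, hjlt⟩, b⟩, hb⟩ hi x
  rcases Nat.eq_zero_or_pos j with hj | hj
  · subst hj
    by_cases hΩb' : Ω b
    · exact absurd (fun y => (level_zero_dichotomy D Ω b hb y).1 hΩb') hi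
    · exact (level_zero_dichotomy D Ω b hb x).2 hΩb'
  · exact absurd (QE_cutB_apply_of_blocks D Ω _ (hΩb _ hj)) hi

/-! ## §3. The locality of the minimiser under the geometric conditions -/

open Classical in
/-- **LOCALITY OF THE MINIMISER, GEOMETRIC FORM**: for every bond set `Ω` with the one-step margin around `Ω₁` (`IsMargin`) and
the block margin (`IsBlockMargin`), every nested family of domains, `c ≠ 0`, `a > 0` and every datum `B`, the minimiser
`HB = GQ*(QGQ*)⁻¹B` of (2.5)–(2.6), (2.12) restricted to the bonds of `Ω` is the printed expression
`G(Ω)Q*_I E B↾I + G(Ω)Q*_I E Q_IG(Ω)∂*∂X − G(Ω)∂*∂X`, `E = (Q_IG(Ω)Q*_I)⁻¹`, `X = HB − Ω(HB)` the configuration off `Ω`, `I` the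
constraints that do not see the cut-off (gen 6's `hOp_local` with its dichotomy hypotheses discharged).
[cite: Balaban1984PropagatorsII, p.228 (representation of A with G(Ω))] -/
theorem hOp_local_geometric (hΩ : IsMargin D Ω) (hΩb : IsBlockMargin D Ω) {c : ℝ} (hc : c ≠ 0) {w : BondIdx D → ℝ}
    (hw : ∀ i, 0 < w i) (B : BondIdxSpace D) {X : BondSpace P}
    (hX : X = B6SectA.hOp (GE D hc hw) (QsE D) (EE D hc hw) B - cutB Ω (B6SectA.hOp (GE D hc hw) (QsE D) (EE D hc hw) B)) :
    cutB Ω (B6SectA.hOp (GE D hc hw) (QsE D) (EE D hc hw) B) =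
      B6SectA.hOp (GOmegaE D hc hw Ω) (QsIn D fun i => ∀ x : BondSpace P, QE D (cutB Ω x) i = QE D x i)
          (EIn D (isInterior_sem D Ω) hc hw)
          ((zeroExt D fun i => ∀ x : BondSpace P, QE D (cutB Ω x) i = QE D x i).rangeRestrict B)
        + B6SectA.hOp (GOmegaE D hc hw Ω) (QsIn D fun i => ∀ x : BondSpace P, QE D (cutB Ω x) i = QE D x i)
            (EIn D (isInterior_sem D Ω) hc hw)
            (QIn D (fun i => ∀ x : BondSpace P, QE D (cutB Ω x) i = QE D x i) (GOmegaE D hc hw Ω (dcsE c (dcE c X))))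
        - GOmegaE D hc hw Ω (dcsE c (dcE c X)) :=
  hOp_local D hΩ (isInterior_sem D Ω) (isExterior_of_blockMargin D hΩb) hc hw B hX

open Classical in
/-- ***"(2.35) with G(Ω) instead of G"*, GEOMETRIC FORM**: if moreover the minimiser vanishes off `Ω`, then
`HB = G(Ω)Q*_I(Q_IG(Ω)Q*_I)⁻¹B↾I`. [cite: Balaban1984PropagatorsII, p.228 ((2.35) with G(Ω))] -/
theorem hOp_eq_GOmega_of_exterior_zero (hΩ : IsMargin D Ω) (hΩb : IsBlockMargin D Ω) {c : ℝ} (hc : c ≠ 0)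
    {w : BondIdx D → ℝ} (hw : ∀ i, 0 < w i) (B : BondIdxSpace D)
    (h0 : cutB Ω (B6SectA.hOp (GE D hc hw) (QsE D) (EE D hc hw) B) = B6SectA.hOp (GE D hc hw) (QsE D) (EE D hc hw) B) :
    B6SectA.hOp (GE D hc hw) (QsE D) (EE D hc hw) B =
      B6SectA.hOp (GOmegaE D hc hw Ω) (QsIn D fun i => ∀ x : BondSpace P, QE D (cutB Ω x) i = QE D x i)
        (EIn D (isInterior_sem D Ω) hc hw)
        ((zeroExt D fun i => ∀ x : BondSpace P, QE D (cutB Ω x) i = QE D x i).rangeRestrict B) :=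
  hOp_local_of_exterior_zero D hΩ (isInterior_sem D Ω) (isExterior_of_blockMargin D hΩb) hc hw B h0

end Literature.MathematicalPhysics.QuantumFieldTheory.Balaban1983to89.B6GOmegaMarginV1

end
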